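import Mathlib.Algebra.MonoidAlgebra.Basic
import Mathlib.Algebra.MonoidAlgebra.Module
import Mathlib.Algebra.Algebra.Pi
import Mathlib.LinearAlgebra.Matrix.ToLin
import Mathlib.LinearAlgebra.Dimension.Constructions
import Mathlib.LinearAlgebra.FiniteDimensional.Defs
import Mathlib.Analysis.SpecialFunctions.Pow.Real
import Literature.Computability.AlgebraicComplexity.MatrixMultiplicationExponent
import Literature.Computability.AlgebraicComplexity.FlatteningBound
import Literature.RepresentationTheory.FiniteGroups.CharacterDegrees
import HarnessLib

/-!
# The Cohn–Umans inequality: triple-product-property realizations and character degrees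

Topic: `Literature/Computability/AlgebraicComplexity`. Work item `wi-04466` (fact request for the
`MatrixMultiplication` survey): the fundamental inequality of the group-theoretic approach to fast
matrix multiplication,

* **Cohn–Umans 2003, Thm. 4.1 = Cohn–Kleinberg–Szegedy–Umans 2005, Thm. 1.8.** If a finite group
  `G` realizes `⟨n, m, p⟩` (through subsets satisfying the triple product property) and the
  character degrees of `G` are `{dᵢ}`, then `(nmp)^{ω/3} ≤ ∑ᵢ dᵢ^ω`
  (`CKSU2005_thm18`);
* **CKSU 2005, Cor. 1.9.** With `d` the largest character degree, `(nmp)^{ω/3} ≤ d^{ω-2} |G|`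
  (`CKSU2005_cor19`);
* **Cohn–Umans 2003, Lemma 3.1** (abelian groups are useless): if `G` is abelian and realizes
  `⟨n, m, p⟩` then `nmp ≤ |G|` (*proved*: `RealizesTPP.mul_mul_le_card`); for every `G`,
  `nm ≤ |G|` as soon as `p ≠ 0` (*proved*: `RealizesTPP.mul_le_card`).

Here `ω = Literature.CplxAlg.omega ℂ` is the exponent of matrix multiplication over `ℂ`
(`MatrixMultiplicationExponent.lean`, Bläser 2013 Def. 5.1).

## Definitions

* `RealizesTPP G n m p` — "`G` realizes `⟨n, m, p⟩`" (Cohn–Umans 2003, Def. 2.1 = CKSU 2005,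
  Def. 1.3): there are `S, T, U ⊆ G` with `|S| = n`, `|T| = m`, `|U| = p` satisfying the
  *triple product property*: for `q₁ ∈ Q(S)`, `q₂ ∈ Q(T)`, `q₃ ∈ Q(U)` (right quotient sets
  `Q(S) = {s s'⁻¹}`), `q₁ q₂ q₃ = 1 ⟹ q₁ = q₂ = q₃ = 1`. The property is spelled out
  element-wise (`s s'⁻¹ · t t'⁻¹ · u u'⁻¹ = 1 → s = s' ∧ t = t' ∧ u = u'`) so that this file is
  self-contained; it is literally the `Q(S)`-form of CKSU Def. 1.3.
* Character degrees are the tree's (`Literature/RepresentationTheory/FiniteGroups/CharacterDegrees.lean`,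
  `Literature.RepTheory`): `charDegreePowSum G s = ∑_{χ irreducible} χ(1)^s`, `maxCharDegree G`, with the
  facts `irrChars_finite`, `sum_sq_charDegrees` (`∑ dᵢ² = |G|`) stated there. Both facts here are typed
  on that API (`G : Type`, `[Finite G]`, `Nat.card G`), as requested by stmt-MatrixMultiplication-0597.

## Sources (statements verified by `lit read`)

* H. Cohn, C. Umans, *A group-theoretic approach to fast matrix multiplication*, FOCS 2003,
  438–449, arXiv:math/0307321: Def. 2.1 (p. 3), Lemma 3.1 and its proof (p. 4: "If `G` is
  abelian, then the product map `S₁ × S₂ × S₃ → G` must be injective, so `|G| ≥ n₁n₂n₃`";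
  "the map `(x, y) ↦ x⁻¹y` is injective on `S₁ × S₂` … Thus, `|G| ≥ n₁n₂`"), Thm. 4.1 (p. 5,
  pseudo-exponent form `|G|^{ω/α} ≤ ∑ dᵢ^ω`).
* H. Cohn, R. Kleinberg, B. Szegedy, C. Umans, *Group-theoretic algorithms for matrix
  multiplication*, FOCS 2005, 379–388, arXiv:math/0511460: §1.1 (character degrees, `|G| = ∑ dᵢ²`),
  Def. 1.3, Thm. 1.8 ("Suppose `G` realizes `⟨n, m, p⟩` and the character degrees of `G` are `{dᵢ}`.
  Then `(nmp)^{ω/3} ≤ ∑ᵢ dᵢ^ω`."), Cor. 1.9 ("… has largest character degree `d`. Then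
  `(nmp)^{ω/3} ≤ d^{ω-2}|G|`."), §2 (Thm. 1.8 rules out `ω = 3` iff `nmp > ∑ dᵢ³`) — p. 3.

## Design notes / wording risks

* Thm. 4.1 of Cohn–Umans 2003 is stated with the pseudo-exponent `α(G)`
  (`|G|^{3/α} = max nmp` over realizations); since `t ↦ t^{ω/3}` is monotone, it is equivalent to
  the realization-wise form of CKSU Thm. 1.8, which is the one vendored (and the one requested).
* `RealizesTPP` allows `n`, `m` or `p` to be `0` (then the TPP is vacuous); Thm. 1.8 is trivially true
  in that case (`0 ≤ ∑ dᵢ^ω`), so no generality is falsely added.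
* "Largest character degree" in Cor. 1.9 is the tree's `maxCharDegree G`. Cor. 1.9 is *not* re-derived
  from Thm. 1.8 here (that needs `∑ dᵢ² = |G|` and finiteness of `irrChars`, which are named facts of
  `CharacterDegrees.lean`, plus `χ(1) ≤ d_max`); it is vendored as printed. `2 ≤ ω ≤ 3` are the
  tree's `omega_two_le` / `omega_le_three'` (`FlatteningBound.lean`), so `omega_lt_three` below is
  unconditional in them.
* The named facts are `def … : Prop` (D-0014); Thm. 1.8 is deep (tensor powers of
  `⟨n,m,p⟩ ≤ ℂ[G]` plus `R(⟨k,k,k⟩) ≤ C k^{ω+ε}`), no discharge is attempted.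
-/

noncomputable section

open scoped BigOperators
open Finset

namespace Literature.Computability.AlgebraicComplexity

universe u v

/-! ## Realizing `⟨n, m, p⟩` through the triple product property -/

section RealizesTPP

variable (G : Type u) [Group G]

/-- **`G` realizes `⟨n, m, p⟩`** (Cohn–Umans 2003, Def. 2.1; CKSU 2005, Def. 1.3): there are subsets
`S, T, U ⊆ G` with `|S| = n`, `|T| = m`, `|U| = p` satisfying the *triple product property*:
whenever `q₁ q₂ q₃ = 1` with `q₁ = s s'⁻¹ ∈ Q(S)`, `q₂ = t t'⁻¹ ∈ Q(T)`, `q₃ = u u'⁻¹ ∈ Q(U)`, then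
`q₁ = q₂ = q₃ = 1`, i.e. `s = s'`, `t = t'`, `u = u'`.
[cite: CohnKleinbergSzegedyUmans2005, Def. 1.3] -/
def RealizesTPP (n m p : ℕ) : Prop :=
  ∃ S T U : Finset G, S.card = n ∧ T.card = m ∧ U.card = p ∧
    ∀ s ∈ S, ∀ s' ∈ S, ∀ t ∈ T, ∀ t' ∈ T, ∀ u ∈ U, ∀ u' ∈ U,
      s * s'⁻¹ * (t * t'⁻¹) * (u * u'⁻¹) = 1 → s = s' ∧ t = t' ∧ u = u'

variable {G}

/-- The trivial realization: every finite group realizes `⟨1, 1, |G|⟩` through `{1}, {1}, G`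
(Cohn–Umans 2003, proof of Lemma 3.1: "use the subgroups `H₁ = H₂ = {1}` and `H₃ = G`").
[cite: CohnUmans2003, Lemma 3.1 (proof)] -/
theorem realizesTPP_one_one_card [Fintype G] : RealizesTPP G 1 1 (Fintype.card G) := by
  refine ⟨{1}, {1}, Finset.univ, by simp, by simp, Finset.card_univ, ?_⟩
  intro s hs s' hs' t ht t' ht' u _ u' _ h
  simp only [Finset.mem_singleton] at hs hs' ht ht'
  subst hs hs' ht ht'
  refine ⟨rfl, rfl, ?_⟩
  simpa [mul_inv_eq_one] using h

/-- Packing bound (Cohn–Umans 2003, proof of Lemma 3.1): if `G` realizes `⟨n, m, p⟩` with `p ≠ 0`,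
then `(x, y) ↦ x⁻¹ y` is injective on `S × T`, so `n m ≤ |G|`.
[cite: CohnUmans2003, Lemma 3.1 (proof)] -/
theorem RealizesTPP.mul_le_card [Fintype G] {n m p : ℕ} (h : RealizesTPP G n m p) (hp : p ≠ 0) :
    n * m ≤ Fintype.card G := by
  classical
  obtain ⟨S, T, U, hS, hT, hU, hTPP⟩ := h
  obtain ⟨u, hu⟩ : U.Nonempty := by
    rw [← Finset.card_pos, hU]; exact Nat.pos_of_ne_zero hp
  have hinj : Set.InjOn (fun x : G × G => x.1⁻¹ * x.2) ↑(S ×ˢ T) := by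
    rintro ⟨s, t⟩ hst ⟨s', t'⟩ hst' (he : s⁻¹ * t = s'⁻¹ * t')
    simp only [Finset.coe_product, Set.mem_prod, Finset.mem_coe] at hst hst'
    have key : s' * s⁻¹ * (t * t'⁻¹) * (u * u⁻¹) = 1 := by
      rw [mul_inv_cancel, mul_one, mul_assoc, ← mul_assoc s⁻¹, he]; group
    obtain ⟨h1, h2, -⟩ := hTPP s' hst'.1 s hst.1 t hst.2 t' hst'.2 u hu u hu key
    exact Prod.ext h1.symm h2
  calc n * m = (S ×ˢ T).card := by rw [Finset.card_product, hS, hT]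
    _ = ((S ×ˢ T).image fun x : G × G => x.1⁻¹ * x.2).card := (Finset.card_image_of_injOn hinj).symm
    _ ≤ Fintype.card G := Finset.card_le_univ _

/-- **Cohn–Umans 2003, Lemma 3.1 (abelian case)**: if an abelian group `G` realizes `⟨n, m, p⟩` then
the product map `S × T × U → G` is injective, hence `n m p ≤ |G|` (so the pseudo-exponent of an
abelian group is `3`: abelian groups cannot give non-trivial bounds on `ω` this way).
[cite: CohnUmans2003, Lemma 3.1] -/
theorem RealizesTPP.mul_mul_le_card {G : Type u} [CommGroup G] [Fintype G] {n m p : ℕ}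
    (h : RealizesTPP G n m p) : n * m * p ≤ Fintype.card G := by
  classical
  obtain ⟨S, T, U, hS, hT, hU, hTPP⟩ := h
  have hinj : Set.InjOn (fun x : G × G × G => x.1 * x.2.1 * x.2.2) ↑(S ×ˢ T ×ˢ U) := by
    rintro ⟨s, t, u⟩ hx ⟨s', t', u'⟩ hx' (he : s * t * u = s' * t' * u')
    simp only [Finset.coe_product, Set.mem_prod, Finset.mem_coe] at hx hx'
    have key : s * s'⁻¹ * (t * t'⁻¹) * (u * u'⁻¹) = 1 := by
      calc s * s'⁻¹ * (t * t'⁻¹) * (u * u'⁻¹) = (s * t * u) * (s' * t' * u')⁻¹ := by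
            simp only [mul_inv_rev]; simp only [mul_comm, mul_left_comm, mul_assoc]
        _ = 1 := by rw [he, mul_inv_cancel]
    obtain ⟨h1, h2, h3⟩ := hTPP s hx.1 s' hx'.1 t hx.2.1 t' hx'.2.1 u hx.2.2 u' hx'.2.2 key
    simp [h1, h2, h3]
  calc n * m * p = (S ×ˢ T ×ˢ U).card := by
        rw [Finset.card_product, Finset.card_product, hS, hT, hU, mul_assoc]
    _ = ((S ×ˢ T ×ˢ U).image fun x : G × G × G => x.1 * x.2.1 * x.2.2).card :=
        (Finset.card_image_of_injOn hinj).symm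
    _ ≤ Fintype.card G := Finset.card_le_univ _

end RealizesTPP

/-! ## The named facts -/

open Literature.RepresentationTheory.FiniteGroups

/-- **Cohn–Umans 2003, Thm. 4.1 = Cohn–Kleinberg–Szegedy–Umans 2005, Thm. 1.8.** "Suppose `G`
realizes `⟨n, m, p⟩` and the character degrees of `G` are `{dᵢ}`. Then
`(nmp)^{ω/3} ≤ ∑ᵢ dᵢ^ω`." Here `ω = omega ℂ` is the exponent of matrix multiplication over `ℂ` and
`∑ᵢ dᵢ^ω = charDegreePowSum G ω = ∑_{χ irreducible} χ(1)^ω` (tree API). (Cohn–Umans state it as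
`|G|^{ω/α} ≤ ∑ᵢ dᵢ^ω` with `α` the pseudo-exponent, `|G|^{3/α} = max nmp`; the two forms are
equivalent by monotonicity of `t ↦ t^{ω/3}`.) [cite: CohnKleinbergSzegedyUmans2005, Thm. 1.8] -/
def CKSU2005_thm18 : Prop :=
  ∀ (G : Type) [Group G] [Finite G] (n m p : ℕ), RealizesTPP G n m p →
    ((n * m * p : ℕ) : ℝ) ^ (omega ℂ / 3) ≤ charDegreePowSum G (omega ℂ)

/-- **Cohn–Kleinberg–Szegedy–Umans 2005, Cor. 1.9** (the form in which Thm. 1.8 "is generally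
applied"): "Suppose `G` realizes `⟨n, m, p⟩` and has largest character degree `d`. Then
`(nmp)^{ω/3} ≤ d^{ω-2} |G|`." The largest character degree is the tree's `maxCharDegree G`.
[cite: CohnKleinbergSzegedyUmans2005, Cor. 1.9] -/
def CKSU2005_cor19 : Prop :=
  ∀ (G : Type) [Group G] [Finite G] (n m p : ℕ), RealizesTPP G n m p →
    ((n * m * p : ℕ) : ℝ) ^ (omega ℂ / 3) ≤ (maxCharDegree G : ℝ) ^ (omega ℂ - 2) * Nat.card G

/-- **Beating the sum of the cubes** (CKSU 2005, §2; Cohn–Umans 2003, Question 4.1): Thm. 1.8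
rules out `ω = 3` as soon as some group realizes `⟨n, m, p⟩` with `nmp > ∑ᵢ dᵢ³`.
[cite: CohnKleinbergSzegedyUmans2005, §2] -/
theorem CKSU2005_thm18.omega_ne_three (h18 : CKSU2005_thm18) {G : Type} [Group G] [Finite G]
    {n m p : ℕ} (hr : RealizesTPP G n m p) (hlt : charDegreePowSum G 3 < (n * m * p : ℕ)) :
    omega ℂ ≠ 3 := by
  intro h3
  have h := h18 G n m p hr
  rw [h3, div_self three_ne_zero, Real.rpow_one] at h
  exact absurd h (not_le.2 hlt)

/-- Since `ω ≤ 3` unconditionally (`omega_le_three'`, `FlatteningBound.lean`), beating the sum of the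
cubes gives `ω < 3`. [cite: CohnKleinbergSzegedyUmans2005, §2] -/
theorem CKSU2005_thm18.omega_lt_three (h18 : CKSU2005_thm18) {G : Type} [Group G] [Finite G]
    {n m p : ℕ} (hr : RealizesTPP G n m p) (hlt : charDegreePowSum G 3 < (n * m * p : ℕ)) :
    omega ℂ < 3 :=
  lt_of_le_of_ne (omega_le_three' (K := ℂ)) (h18.omega_ne_three hr hlt)

/-- Cor. 1.9 makes `d_max^{ω-2} |G|` an upper bound for `(nmp)^{ω/3}`; with `2 ≤ ω` (`omega_two_le`)
the exponent `ω - 2` is non-negative, so the bound is monotone in any upper bound `D ≥ d_max` of the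
character degrees. [cite: CohnKleinbergSzegedyUmans2005, Cor. 1.9] -/
theorem CKSU2005_cor19.rpow_le_of_maxCharDegree_le (h19 : CKSU2005_cor19) {G : Type} [Group G]
    [Finite G] {n m p : ℕ} (hr : RealizesTPP G n m p) {D : ℕ} (hD : maxCharDegree G ≤ D) :
    ((n * m * p : ℕ) : ℝ) ^ (omega ℂ / 3) ≤ (D : ℝ) ^ (omega ℂ - 2) * Nat.card G := by
  refine (h19 G n m p hr).trans ?_
  refine mul_le_mul_of_nonneg_right ?_ (Nat.cast_nonneg _)
  exact Real.rpow_le_rpow (Nat.cast_nonneg _) (by exact_mod_cast hD)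
    (sub_nonneg.2 (omega_two_le (K := ℂ)))

end Literature.Computability.AlgebraicComplexity

end
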